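import Literature.NumberTheory.Sieve.FGKMT2018Theorem4Proof
import Literature.Combinatorics.Hypergraph.FGKMT2018Theorem3Proof
import HarnessLib

/-!
# Ford–Green–Konyagin–Maynard–Tao 2018: Theorem 1 (large gaps between primes) from Theorem 5 alone

Topic `Literature/NumberTheory/Sieve`. Source: K. Ford, B. Green, S. Konyagin, J. Maynard, T. Tao,
*Long gaps between primes*, J. Amer. Math. Soc. 31 (2018) 65–105 = arXiv:1412.5029
[FordGreenKonyaginMaynardTao2018], §§3–6: Theorem 1 ⇐ (1.2) ⇐ Theorem 2 ⇐ {Corollary 3 ⇐ Theorem 3,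
Theorem 4 ⇐ Theorem 5}.

With the probabilistic covering theorem now PROVED (`Literature.Combinatorics.Hypergraph.fgkmt2018_theorem3`,
file `FGKMT2018Theorem3Proof`, constant `C₀ = 10`), the chain of `FGKMT2018Theorem4Proof` loses its
Theorem-3 hypothesis: this file records the unconditional Corollary 3′ and the deductions
Theorem 5 ⟹ Theorem 2 ⟹ Theorem 1 ⟹ `RankinConstant κ` for every `κ`. The only remaining named
input is `FordGreenKonyaginMaynardTao2018_theorem5` (the sieve weights of §§6–8).
-/

namespace Literature.NumberTheory.Sieve

/-- **Corollary 3′ holds unconditionally** (Theorem 3 is proved).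
[cite: FordGreenKonyaginMaynardTao2018, Corollary 3 pp. 11–13 from Theorem 3 (§5)] -/
theorem fgkmt2018_corollary3 : FGKMT2018_corollary3 :=
  fgkmt2018_corollary3_of_theorem3 Literature.Combinatorics.Hypergraph.fgkmt2018_theorem3

/-- **Theorem 2 (sieving primes) from Theorem 5.**
[cite: FordGreenKonyaginMaynardTao2018, Thm 2 from Thm 3 (§5, proved) + Thm 5 (§§6–8)] -/
theorem fgkmt2018_theorem2_of_theorem5 (h5 : FordGreenKonyaginMaynardTao2018_theorem5) :
    FordGreenKonyaginMaynardTao2018_theorem2 :=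
  fgkmt2018_theorem2_of_theorem3_theorem5 Literature.Combinatorics.Hypergraph.fgkmt2018_theorem3 h5

/-- **Theorem 1 (`G(X) ≫ log X log₂ X log₄ X / log₃ X`) from Theorem 5.**
[cite: FordGreenKonyaginMaynardTao2018, Thm 1 from Thm 5 via Thms 2, 3, 4 (§§3–6)] -/
theorem fgkmt2018_theorem1_of_theorem5 (h5 : FordGreenKonyaginMaynardTao2018_theorem5) :
    FordGreenKonyaginMaynardTao2018_theorem1 :=
  fgkmt2018_theorem1_of_theorem3_theorem5 Literature.Combinatorics.Hypergraph.fgkmt2018_theorem3 h5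

/-- **Every Rankin constant from Theorem 5**: `RankinConstant κ` for all real `κ`.
[cite: FordGreenKonyaginMaynardTao2018, Thm 1 ⇒ Rankin's conjecture (§1)] -/
theorem rankinConstant_of_fgkmt2018_theorem5 (h5 : FordGreenKonyaginMaynardTao2018_theorem5) (κ : ℝ) :
    RankinConstant κ :=
  rankinConstant_of_fgkmt2018_theorem3_theorem5 Literature.Combinatorics.Hypergraph.fgkmt2018_theorem3 h5 κ

end Literature.NumberTheory.Sieve
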